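import Literature.NumberTheory.NumberFields.NarrowClassGroupTwoRankQuadraticGenus
import Literature.NumberTheory.NumberFields.NarrowClassGroupTwoRankOddClassNumber
import HarnessLib

/-!
# The narrow genus RANK INEQUALITY of a totally real quadratic extension:
# `[Cl⁺(L):(Cl⁺(L))²] · 2 · [E_K⁺ : E_K⁺ ∩ N Lˣ] · #(Cap ∩ Cl⁺(K)[2]) ∣ h⁺(K) · [Cl⁺(K):(Cl⁺(K))²] · ∏_𝔭 e_𝔭`
# — so `rank₂ Cl⁺(L) ≤ 2·rank₂ Cl⁺(K) + t − 1 − i⁺ − c` when `h(K)` is odd, with ONE-WITNESS corollaries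

Topic `NumberTheory/NumberFields`; namespace `Literature.NumberTheory.NumberFields.AmbiguousClass`.  THEOREM-ONLY file (no definition, no named
fact, no instance, no `sorry`), written by the prover seat `bsd-2adic-k4-w2` GEN 13 (cell `bsd-2adic`; `--supports` stmt-BirchSwinnertonDyer-22617;
closes nothing).  Sequel of `NarrowClassGroupTwoRankQuadraticGenus.lean` (cruxlead-19573-w2 GEN 12: the EXACT rank `t − 1` when `h⁺(K)` is ODD) for
the case the narrow census actually meets above layer `0`: `h(K)` odd but `h⁺(K)` EVEN (`rank₂ Cl⁺(K) = ρ_K ≥ 1`).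

THE THEOREM (`index_range_pow_two_narrowClassGroup_mul_dvd`).  `L/K` Galois of degree `2` (`Gal = ⟨σ⟩`), `L` totally real.  Write
`A = 𝓘_L/P_L⁺ ≅ Cl⁺(L)`, `T = A[2]` (`#T = [Cl⁺(L):(Cl⁺(L))²]`), `F = A^G`, `ι : 𝓘_K → 𝓘_L`,
`S_K = {J ∈ 𝓘_K : J² ∈ P_K⁺}` (`[S_K : P_K⁺] = [Cl⁺(K):(Cl⁺(K))²]`), `Cap = ι⁻¹(P_L⁺)` (the narrow classes of `K` that capitulate in `L`),
`U⁺ = [E_K⁺ : E_K⁺ ∩ N_G Lˣ]` (the printed unit index of the narrow ambiguous class number formula, tree `ambiguousNarrowClassNumberFormula'`),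
`C = [Cap ∩ S_K : P_K⁺] = #(capitulation kernel ∩ Cl⁺(K)[2])`.  Then

  **`#T · 2 · U⁺ · C ∣ h⁺(K) · [S_K : P_K⁺] · ∏_𝔭 e_𝔭(L/K)`.**

PROOF (Fröhlich–Taylor V §2 / Gras IV.4 genus counting, NO norm-surjectivity needed since only the inequality is claimed).  The map
`ψ(a) = a · σa` on `T` is a homomorphism with kernel `T ∩ F` (for `a² = 1`: `a·σa = 1 ⟺ σa = a`), so `#T = #(T ∩ F) · #ψ(T)`;
`#(T ∩ F) ∣ #F` and `#F · 2 · U⁺ = h⁺(K) · ∏ e_𝔭` (Chevalley's narrow formula); `ψ(T) ≤ ḡ(S_K)` where `g = (𝓘_K → 𝓘_L → A)` — the norm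
`a · σa = [N_G I]` of a class with `I² = (b)`, `b ≫ 0`, is `[ι J]` with `J² = (N b)`, `N b ≫ 0` in `K` (§1) — and `#g(S_K) = [S_K : Cap ∩ S_K]`,
`[S_K : P_K⁺] = C · #g(S_K)`.  When `h(K)` is odd, `h⁺(K) = h(K) · [Cl⁺(K):(Cl⁺(K))²]` (tree N1) and the `2`-parts give
`ρ_L ≤ 2ρ_K + t − 1 − i⁺ − c` (`…_of_odd_classNumber`: `[Cl⁺(L):(Cl⁺(L))²] · 2 · U⁺ · C ∣ h(K) · [Cl⁺(K):(Cl⁺(K))²]² · ∏ e_𝔭`).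

WITNESSES and the certificate corollaries (`2 ∣ U⁺` from ONE totally positive non-norm unit, `2 ∣ C` from ONE capitulating class,
`[Cl⁺(L):(Cl⁺(L))²] · 8 ∣ [Cl⁺(K):(Cl⁺(K))²]² · ∏ e_𝔭`) are the sequel file `NarrowGenusRankCertificate.lean`.

* §0 `index_range_pow_two_narrowClassGroup_eq_card_twoTorsion` (transport `Cl⁺ ↔ 𝓘/P⁺`), `relIndex_totPosPrincipalIdeals_sqComap_eq` (`[S_K : P_K⁺] = [Cl⁺(K):(Cl⁺(K))²]`).
* §1 `exists_norm_eq_extended_of_sq_mem` — norms of classes killed by `2` are extended from `S_K`.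
* §2 ★ `index_range_pow_two_narrowClassGroup_mul_dvd` (master), `…_of_odd_classNumber`.
References: [Gras2003] IV.4 (genus theory with signatures; the genus exact sequence); [FrohlichTaylor1990] Ch. V §1–§2 (narrow genus theory,
`C⁺/C⁺²` counting); [Lang1990] Ch. 13 §4 Lemma 4.1 (ambiguous class number formula); [Yu2014AmbiguousClassNumberFormulas] Thm. 1.1;
[EdgarMollinPeterson1986] Thm. 2.1 (the reverse inequality `ρ_K ≤ ρ_L` for odd class numbers).
-/

noncomputable section

open NumberField NumberField.InfinitePlace IsDedekindDomain FractionalIdeal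
open scoped nonZeroDivisors Pointwise

namespace Literature.NumberTheory.NumberFields.AmbiguousClass

open Literature.NumberTheory.GaloisRepresentations Literature.NumberTheory.GaloisRepresentations.Herbrand
  Literature.NumberTheory.GaloisRepresentations.MinkowskiUnit
  Literature.NumberTheory.GaloisRepresentations.CyclicNormIndex
  Literature.NumberTheory.NumberFields.AmbiguousIdeal

/-! ### §0 Transport `Cl⁺ ↔ 𝓘/P⁺` and the `K`-side count -/

section Transport

variable (K : Type) [Field K] [NumberField K]

/-- **`[Cl⁺(K) : (Cl⁺(K))²] = #(𝓘_K/P_K⁺)[2]`**: transport of the index of squares along the canonical bijection `Cl⁺(K) = 𝓘_K/P_K⁺` and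
`[A : A²] = #A[2]`. [cite: FrohlichTaylor1990, Ch. V §1–§2 (`C⁺/C⁺²`), pp. 163–165] -/
theorem index_range_pow_two_narrowClassGroup_eq_card_twoTorsion :
    (powMonoidHom (α := NarrowClassGroup K) 2).range.index =
      Nat.card (powMonoidHom (α := (FractionalIdeal (𝓞 K)⁰ K)ˣ ⧸ totPosPrincipalIdeals K) 2).ker := by
  classical
  haveI : Finite ((FractionalIdeal (𝓞 K)⁰ K)ˣ ⧸ totPosPrincipalIdeals K) := by
    apply Nat.finite_of_card_ne_zero
    change (totPosPrincipalIdeals K).index ≠ 0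
    rw [← narrowClassNumber_eq_index]
    haveI : Finite (NarrowClassGroup K) := finite_rayClassGroup top_ne_bot
    exact Nat.card_pos.ne'
  set P : Subgroup (FractionalIdeal (𝓞 K)⁰ K)ˣ := totPosPrincipalIdeals K with hP
  set mk : (FractionalIdeal (𝓞 K)⁰ K)ˣ →* (FractionalIdeal (𝓞 K)⁰ K)ˣ ⧸ P := QuotientGroup.mk' P with hmk
  have hmk_surj : Function.Surjective mk := QuotientGroup.mk'_surjective P
  have hmk_eq : ∀ I J : (FractionalIdeal (𝓞 K)⁰ K)ˣ, mk I = mk J ↔ I⁻¹ * J ∈ P := fun I J => QuotientGroup.eq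
  set T₀ : Subgroup (FractionalIdeal (𝓞 K)⁰ K)ˣ := idealsPrimeTo (⊤ : Ideal (𝓞 K)) with hT₀
  set R : Subgroup T₀ := (ray (⊤ : Ideal (𝓞 K))).subgroupOf T₀ with hR
  have hRP : R ≤ P.comap T₀.subtype := by
    intro x hx
    rw [hR, Subgroup.mem_subgroupOf, ray_top] at hx
    exact hx
  set e₀ : T₀ ⧸ R →* (FractionalIdeal (𝓞 K)⁰ K)ˣ ⧸ P := QuotientGroup.map R P T₀.subtype hRP with he₀
  have he₀mk : ∀ x : T₀, e₀ (QuotientGroup.mk x) = mk (x : (FractionalIdeal (𝓞 K)⁰ K)ˣ) := fun x => rfl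
  have hbij : Function.Bijective e₀ := by
    constructor
    · intro q₁ q₂ h
      obtain ⟨x₁, rfl⟩ := QuotientGroup.mk_surjective q₁
      obtain ⟨x₂, rfl⟩ := QuotientGroup.mk_surjective q₂
      rw [he₀mk, he₀mk, hmk_eq] at h
      refine QuotientGroup.eq.mpr ?_
      rw [hR, Subgroup.mem_subgroupOf, ray_top, Subgroup.coe_mul, Subgroup.coe_inv]
      exact h
    · intro q
      obtain ⟨I, rfl⟩ := hmk_surj q
      exact ⟨QuotientGroup.mk ⟨I, by rw [hT₀, idealsPrimeTo_top]; trivial⟩, he₀mk _⟩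
  have hmap : ((powMonoidHom (α := T₀ ⧸ R) 2).range).map e₀ =
      (powMonoidHom (α := (FractionalIdeal (𝓞 K)⁰ K)ˣ ⧸ P) 2).range := by
    ext y
    constructor
    · rintro ⟨x, ⟨z, rfl⟩, rfl⟩
      exact ⟨e₀ z, by rw [powMonoidHom_apply, powMonoidHom_apply, map_pow]⟩
    · rintro ⟨y, rfl⟩
      obtain ⟨q, rfl⟩ := hbij.2 y
      exact ⟨q ^ 2, ⟨q, rfl⟩, by rw [powMonoidHom_apply, map_pow]⟩
  have htransport : (powMonoidHom (α := (FractionalIdeal (𝓞 K)⁰ K)ˣ ⧸ P) 2).range.index =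
      (powMonoidHom (α := T₀ ⧸ R) 2).range.index := by
    rw [← hmap, Subgroup.index_map_of_bijective hbij]
  change (powMonoidHom (α := T₀ ⧸ R) 2).range.index = _
  rw [← htransport, index_range_powMonoidHom_eq_card_ker']

/-- **`[S_K : P_K⁺] = [Cl⁺(K) : (Cl⁺(K))²]`** where `S_K = {J ∈ 𝓘_K : J² ∈ P_K⁺}` (the classes killed by `2` are `S_K/P_K⁺`).
[cite: FrohlichTaylor1990, Ch. V §2 (`C⁺/C⁺²` counting), p. 165] -/
theorem relIndex_totPosPrincipalIdeals_sqComap_eq :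
    (totPosPrincipalIdeals K).relIndex ((totPosPrincipalIdeals K).comap (powMonoidHom (α := (FractionalIdeal (𝓞 K)⁰ K)ˣ) 2)) =
      (powMonoidHom (α := NarrowClassGroup K) 2).range.index := by
  classical
  haveI : Finite ((FractionalIdeal (𝓞 K)⁰ K)ˣ ⧸ totPosPrincipalIdeals K) := by
    apply Nat.finite_of_card_ne_zero
    change (totPosPrincipalIdeals K).index ≠ 0
    rw [← narrowClassNumber_eq_index]
    haveI : Finite (NarrowClassGroup K) := finite_rayClassGroup top_ne_bot
    exact Nat.card_pos.ne'
  set P : Subgroup (FractionalIdeal (𝓞 K)⁰ K)ˣ := totPosPrincipalIdeals K with hP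
  set S : Subgroup (FractionalIdeal (𝓞 K)⁰ K)ˣ := P.comap (powMonoidHom (α := (FractionalIdeal (𝓞 K)⁰ K)ˣ) 2) with hS
  set mk : (FractionalIdeal (𝓞 K)⁰ K)ˣ →* (FractionalIdeal (𝓞 K)⁰ K)ˣ ⧸ P := QuotientGroup.mk' P with hmk
  have hmk_ker : mk.ker = P := QuotientGroup.ker_mk' P
  have hmk_surj : Function.Surjective mk := QuotientGroup.mk'_surjective P
  rw [index_range_pow_two_narrowClassGroup_eq_card_twoTorsion]
  -- `A[2] = S/P⁺`
  have hT : (powMonoidHom (α := (FractionalIdeal (𝓞 K)⁰ K)ˣ ⧸ P) 2).ker = S.map mk := by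
    ext a
    constructor
    · intro ha
      obtain ⟨I, rfl⟩ := hmk_surj a
      refine ⟨I, ?_, rfl⟩
      rw [MonoidHom.mem_ker, powMonoidHom_apply, ← map_pow, ← MonoidHom.mem_ker, hmk_ker] at ha
      exact ha
    · rintro ⟨I, hI, rfl⟩
      replace hI : I ^ 2 ∈ P := hI
      rw [MonoidHom.mem_ker, powMonoidHom_apply, ← map_pow, ← MonoidHom.mem_ker, hmk_ker]
      exact hI
  change P.relIndex S = Nat.card (powMonoidHom (α := (FractionalIdeal (𝓞 K)⁰ K)ˣ ⧸ P) 2).ker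
  rw [hT, ← Subgroup.relIndex_ker, hmk_ker]

end Transport

variable {K L : Type} [Field K] [NumberField K] [Field L] [NumberField L] [Algebra K L]

/-! ### §1 Norms of classes killed by `2` are extended from `S_K` -/

/-- **A totally positive element of `L` lying in `K` is totally positive in `K`** (`L/K` unramified at infinity: every real embedding of `K`
extends). [cite: Lang1990, Ch. 13 §4 (archimedean `e(v) = 1`)] [cite: FrohlichTaylor1990, Ch. V §1 (N₊)] -/
theorem mem_ker_signHom_of_unitsIncl_mem [IsUnramifiedAtInfinitePlaces K L] {k : Kˣ}
    (hk : unitsIncl K L k ∈ (signHom L).ker) : k ∈ (signHom K).ker := by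
  rw [mem_ker_signHom_iff] at hk ⊢
  intro ρ
  obtain ⟨ψ, hψ⟩ := exists_realEmbedding_comp_eq_of_isUnramifiedAtInfinitePlaces (K := K) (L := L) ρ
  have h := hk ψ
  rw [coe_unitsIncl, ← RingHom.comp_apply, hψ] at h
  exact h

/-- **The norm of a class killed by `2` is extended from a class killed by `2`**: if `I² ∈ P_L⁺` then `N_G I = ι J` with `J² ∈ P_K⁺`
(`L/K` cyclic, `L` totally real): `N_G I = ι J` for some `J` (tree `norm_mem_range_unitsMap_extendedHom`), and `ι(J²) = N_G(I²) = N_G((b)) = (N_G b)`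
with `b ≫ 0`, `N_G b ∈ Kˣ` totally positive; `ι` is injective. [cite: NeukirchANT1999, Ch. III §1 (1.6) (iv)–(v)] [cite: FrohlichTaylor1990, Ch. V §2] -/
theorem exists_norm_eq_extended_of_sq_mem [IsGalois K L] [IsTotallyReal L] {σ : L ≃ₐ[K] L}
    (hσ : ∀ τ : L ≃ₐ[K] L, τ ∈ Subgroup.zpowers σ) {I : (FractionalIdeal (𝓞 L)⁰ L)ˣ}
    (hI : I ^ 2 ∈ totPosPrincipalIdeals L) :
    ∃ J : (FractionalIdeal (𝓞 K)⁰ K)ˣ,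
      Units.map (extendedHom L (𝓞 L) : FractionalIdeal (𝓞 K)⁰ K →+* FractionalIdeal (𝓞 L)⁰ L).toMonoidHom J =
          Herbrand.norm (L ≃ₐ[K] L) I ∧
        J ^ 2 ∈ totPosPrincipalIdeals K := by
  haveI : IsUnramifiedAtInfinitePlaces K L := isUnramifiedAtInfinitePlaces_of_isTotallyReal
  set ι := (Units.map (extendedHom L (𝓞 L) :
      FractionalIdeal (𝓞 K)⁰ K →+* FractionalIdeal (𝓞 L)⁰ L).toMonoidHom) with hι
  have hinj : Function.Injective ι :=
    Units.map_injective (extendedHom_injective (𝓞 K) K L (𝓞 L))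
  obtain ⟨J, hJ⟩ := norm_mem_range_unitsMap_extendedHom hσ I
  refine ⟨J, hJ, ?_⟩
  -- `I² = (b)` with `b ≫ 0`
  obtain ⟨b, hb, hbI⟩ := hI
  -- `N_G b` is a totally positive element of `K`
  have hNb : Herbrand.norm (L ≃ₐ[K] L) b ∈ (signHom L).ker ⊓ (unitsIncl K L).range := by
    have h1 : Herbrand.norm (L ≃ₐ[K] L) b ∈ ((signHom L).ker).map (Herbrand.norm (L ≃ₐ[K] L)) := ⟨b, hb, rfl⟩
    rw [map_norm_ker_signHom_eq hσ] at h1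
    exact ⟨h1.1, map_norm_top_le_range_unitsIncl hσ h1.2⟩
  obtain ⟨hNbpos, ⟨k, hk⟩⟩ := hNb
  have hkpos : k ∈ (signHom K).ker := mem_ker_signHom_of_unitsIncl_mem (by rw [hk]; exact hNbpos)
  -- `ι(J²) = N_G(I²) = (N_G b) = ι((k))`
  have hπ : ∀ (g : L ≃ₐ[K] L) (x : Lˣ),
      toPrincipalIdeal (𝓞 L) L (g • x) = g • toPrincipalIdeal (𝓞 L) L x := toPrincipalIdeal_smul
  have hιJ2 : ι (J ^ 2) = ι (toPrincipalIdeal (𝓞 K) K k) := by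
    rw [map_pow, hJ, ← map_pow, ← hbI, ← map_norm_eq (toPrincipalIdeal (𝓞 L) L) hπ, hι,
      unitsMap_extendedHom_toPrincipalIdeal, hk]
  rw [hinj hιJ2]
  exact ⟨k, hkpos, rfl⟩

/-! ### §2 The master divisibility -/

/-- ★ **The narrow genus rank inequality (master form)**: `L/K` Galois quadratic (`Gal = ⟨σ⟩`), `L` totally real.  With
`S_K = {J : J² ∈ P_K⁺}`, `Cap = ι⁻¹(P_L⁺)`, `U⁺ = [E_K⁺ : E_K⁺ ∩ N_G Lˣ]` (inside `Lˣ`) and `C = [Cap ∩ S_K : P_K⁺]`: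
`[Cl⁺(L):(Cl⁺(L))²] · 2 · U⁺ · C ∣ h⁺(K) · [Cl⁺(K):(Cl⁺(K))²] · ∏_𝔭 e_𝔭(L/K)` — i.e. `#T = #(T ∩ A^G) · #(T^{1+σ})`,
`#(T ∩ A^G) ∣ #A^G = h⁺(K)·∏e/(2U⁺)` (Chevalley), `#T^{1+σ} · C ∣ [S_K : P_K⁺]`.  No parity hypothesis.
[cite: Gras2003, IV.4 (genus exact sequence)] [cite: FrohlichTaylor1990, Ch. V §2] [cite: Lang1990, Ch. 13 §4, Lemma 4.1] -/
theorem index_range_pow_two_narrowClassGroup_mul_dvd [IsGalois K L] [IsTotallyReal L] {σ : L ≃ₐ[K] L}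
    (hσ : ∀ τ : L ≃ₐ[K] L, τ ∈ Subgroup.zpowers σ) (h2 : Module.finrank K L = 2) :
    (powMonoidHom (α := NarrowClassGroup L) 2).range.index * 2 *
        ((unitsE L ⊓ (signHom L).ker) ⊓ (⊤ : Subgroup Lˣ).map (Herbrand.norm (L ≃ₐ[K] L))).relIndex
          ((unitsE L ⊓ (signHom L).ker) ⊓ (unitsIncl K L).range) *
        (totPosPrincipalIdeals K).relIndex
          ((totPosPrincipalIdeals L).comap (Units.map (extendedHom L (𝓞 L) :
              FractionalIdeal (𝓞 K)⁰ K →+* FractionalIdeal (𝓞 L)⁰ L).toMonoidHom) ⊓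
            (totPosPrincipalIdeals K).comap (powMonoidHom (α := (FractionalIdeal (𝓞 K)⁰ K)ˣ) 2)) ∣
      narrowClassNumber K * (powMonoidHom (α := NarrowClassGroup K) 2).range.index *
        ∏ᶠ v : HeightOneSpectrum (𝓞 K), v.asIdeal.ramificationIdxIn (𝓞 L) := by
  classical
  haveI : FiniteDimensional K L := Module.Finite.of_restrictScalars_finite ℚ K L
  haveI : IsUnramifiedAtInfinitePlaces K L := isUnramifiedAtInfinitePlaces_of_isTotallyReal
  haveI : Finite ((FractionalIdeal (𝓞 L)⁰ L)ˣ ⧸ totPosPrincipalIdeals L) := by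
    apply Nat.finite_of_card_ne_zero
    change (totPosPrincipalIdeals L).index ≠ 0
    rw [← narrowClassNumber_eq_index]
    haveI : Finite (NarrowClassGroup L) := finite_rayClassGroup top_ne_bot
    exact Nat.card_pos.ne'
  -- notation
  set P : Subgroup (FractionalIdeal (𝓞 L)⁰ L)ˣ := totPosPrincipalIdeals L with hP
  set PK : Subgroup (FractionalIdeal (𝓞 K)⁰ K)ˣ := totPosPrincipalIdeals K with hPK
  set ι := (Units.map (extendedHom L (𝓞 L) :
      FractionalIdeal (𝓞 K)⁰ K →+* FractionalIdeal (𝓞 L)⁰ L).toMonoidHom) with hι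
  set S : Subgroup (FractionalIdeal (𝓞 K)⁰ K)ˣ := PK.comap (powMonoidHom (α := (FractionalIdeal (𝓞 K)⁰ K)ˣ) 2) with hS
  set Cap : Subgroup (FractionalIdeal (𝓞 K)⁰ K)ˣ := P.comap ι with hCap
  set U := ((unitsE L ⊓ (signHom L).ker) ⊓ (⊤ : Subgroup Lˣ).map (Herbrand.norm (L ≃ₐ[K] L))).relIndex
      ((unitsE L ⊓ (signHom L).ker) ⊓ (unitsIncl K L).range) with hU
  set Z := z0 σ ⊤ P with hZ
  set mk : (FractionalIdeal (𝓞 L)⁰ L)ˣ →* (FractionalIdeal (𝓞 L)⁰ L)ˣ ⧸ P := QuotientGroup.mk' P with hmk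
  have hmk_ker : mk.ker = P := QuotientGroup.ker_mk' P
  have hmk_surj : Function.Surjective mk := QuotientGroup.mk'_surjective P
  have hmk_eq : ∀ I J : (FractionalIdeal (𝓞 L)⁰ L)ˣ, mk I = mk J ↔ I⁻¹ * J ∈ P := fun I J => QuotientGroup.eq
  -- `σ` on `A`
  set φ : (FractionalIdeal (𝓞 L)⁰ L)ˣ ⧸ P →* (FractionalIdeal (𝓞 L)⁰ L)ˣ ⧸ P :=
    QuotientGroup.map P P (MulDistribMulAction.toMonoidHom (FractionalIdeal (𝓞 L)⁰ L)ˣ σ)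
      (fun x hx => isStable_totPosPrincipalIdeals σ hx) with hφdef
  have hφ : ∀ I : (FractionalIdeal (𝓞 L)⁰ L)ˣ, φ (mk I) = mk (σ • I) := fun I => rfl
  have hnorm : ∀ I : (FractionalIdeal (𝓞 L)⁰ L)ˣ, mk (Herbrand.norm (L ≃ₐ[K] L) I) = mk I * φ (mk I) := fun I => by
    rw [norm_eq_mul_smul_of_finrank_eq_two hσ h2, map_mul, hφ]
  -- `F = A^G = Z/P⁺`
  set F : Subgroup ((FractionalIdeal (𝓞 L)⁰ L)ˣ ⧸ P) := Z.map mk with hF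
  have hPZ : P ≤ Z := fun p hp =>
    mem_z0.mpr ⟨Subgroup.mem_top p, P.div_mem (isStable_totPosPrincipalIdeals σ hp) hp⟩
  have hmemF : ∀ I : (FractionalIdeal (𝓞 L)⁰ L)ˣ, mk I ∈ F ↔ φ (mk I) = mk I := by
    intro I
    have h1 : mk I ∈ F ↔ I ∈ Z := by
      rw [hF, ← Subgroup.mem_comap, Subgroup.comap_map_eq_self (by rw [hmk_ker]; exact hPZ)]
    rw [h1, hZ, mem_z0, hφ, hmk_eq]
    simp only [Subgroup.mem_top, true_and]
    constructor
    · intro h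
      have := P.inv_mem h
      rwa [div_eq_mul_inv, mul_inv_rev, inv_inv, mul_comm] at this
    · intro h
      have := P.inv_mem h
      rwa [mul_inv_rev, inv_inv, mul_comm, ← div_eq_mul_inv] at this
  have hFZ : Nat.card F = P.relIndex Z := by rw [hF, ← Subgroup.relIndex_ker, hmk_ker]
  -- `T = A[2]`
  set T : Subgroup ((FractionalIdeal (𝓞 L)⁰ L)ˣ ⧸ P) :=
    (powMonoidHom (α := (FractionalIdeal (𝓞 L)⁰ L)ˣ ⧸ P) 2).ker with hT
  have hTmem : ∀ a : (FractionalIdeal (𝓞 L)⁰ L)ˣ ⧸ P, a ∈ T ↔ a ^ 2 = 1 := fun a => by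
    rw [hT, MonoidHom.mem_ker, powMonoidHom_apply]
  -- `ψ(a) = a · σa` on `T`
  set ψ : T →* (FractionalIdeal (𝓞 L)⁰ L)ˣ ⧸ P :=
    { toFun := fun a => (a : (FractionalIdeal (𝓞 L)⁰ L)ˣ ⧸ P) * φ a
      map_one' := by rw [OneMemClass.coe_one, map_one, one_mul]
      map_mul' := fun a b => by
        rw [Subgroup.coe_mul, map_mul]
        exact mul_mul_mul_comm (a : (FractionalIdeal (𝓞 L)⁰ L)ˣ ⧸ P) (b : (FractionalIdeal (𝓞 L)⁰ L)ˣ ⧸ P)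
          (φ (a : (FractionalIdeal (𝓞 L)⁰ L)ˣ ⧸ P)) (φ (b : (FractionalIdeal (𝓞 L)⁰ L)ˣ ⧸ P)) } with hψdef
  have hψ : ∀ a : T, ψ a = (a : (FractionalIdeal (𝓞 L)⁰ L)ˣ ⧸ P) * φ a := fun a => rfl
  -- (i) `ker ψ ↪ F`
  have hker_le : (ψ.ker).map T.subtype ≤ F := by
    rintro _ ⟨a, ha, rfl⟩
    obtain ⟨I, hIa⟩ := hmk_surj (a : (FractionalIdeal (𝓞 L)⁰ L)ˣ ⧸ P)
    rw [SetLike.mem_coe, MonoidHom.mem_ker, hψ] at ha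
    have ha2 : (a : (FractionalIdeal (𝓞 L)⁰ L)ˣ ⧸ P) ^ 2 = 1 := (hTmem _).mp a.2
    change (a : (FractionalIdeal (𝓞 L)⁰ L)ˣ ⧸ P) ∈ F
    rw [← hIa] at ha ha2 ⊢
    rw [hmemF]
    -- `mk I · φ(mk I) = 1` and `(mk I)² = 1` ⟹ `φ(mk I) = mk I`
    have hinv : φ (mk I) = (mk I)⁻¹ := eq_inv_of_mul_eq_one_right ha
    rw [hinv, inv_eq_iff_mul_eq_one, ← pow_two, ha2]
  have hker_dvd : Nat.card ψ.ker ∣ Nat.card F := by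
    have h1 : Nat.card ψ.ker = Nat.card ((ψ.ker).map T.subtype) :=
      (Subgroup.card_map_of_injective T.subtype_injective).symm
    rw [h1]
    exact Subgroup.card_dvd_of_le hker_le
  -- (ii) `range ψ ≤ g(S)` with `g = mk ∘ ι`
  set g : (FractionalIdeal (𝓞 K)⁰ K)ˣ →* (FractionalIdeal (𝓞 L)⁰ L)ˣ ⧸ P := mk.comp ι with hg
  have hrange_le : ψ.range ≤ S.map g := by
    rintro _ ⟨a, rfl⟩
    obtain ⟨I, hIa⟩ := hmk_surj (a : (FractionalIdeal (𝓞 L)⁰ L)ˣ ⧸ P)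
    have ha2 : (a : (FractionalIdeal (𝓞 L)⁰ L)ˣ ⧸ P) ^ 2 = 1 := (hTmem _).mp a.2
    rw [← hIa, ← map_pow, ← MonoidHom.mem_ker, hmk_ker] at ha2
    obtain ⟨J, hJ, hJ2⟩ := exists_norm_eq_extended_of_sq_mem hσ ha2
    have hJ' : ι J = Herbrand.norm (L ≃ₐ[K] L) I := hJ
    refine ⟨J, ?_, ?_⟩
    · change J ^ 2 ∈ PK
      exact hJ2
    · rw [hψ, ← hIa, ← hnorm, hg, MonoidHom.comp_apply, hJ']
  have hrange_dvd : Nat.card ψ.range ∣ Nat.card (S.map g) := Subgroup.card_dvd_of_le hrange_le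
  -- (iii) `#T = #ker ψ · #range ψ`
  have hT_card : Nat.card T = Nat.card ψ.ker * Nat.card ψ.range := by
    rw [← Subgroup.index_ker ψ, mul_comm, Subgroup.index_mul_card]
  -- (iv) the `K`-side: `[S : P_K⁺] = C · #g(S)`
  have hPK_le_Cap : PK ≤ Cap := by
    intro J hJ
    rw [hCap, Subgroup.mem_comap]
    exact ((map_totPosPrincipalIdeals_le_z0 (K := K) (L := L) σ).trans z0_le) ⟨J, hJ, rfl⟩
  have hPK_le_S : PK ≤ S := by
    intro J hJ
    rw [hS, Subgroup.mem_comap, powMonoidHom_apply]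
    exact PK.pow_mem hJ 2
  have hg_ker : g.ker = Cap := by
    rw [hg, ← MonoidHom.comap_ker, hmk_ker]
  have hcardgS : Nat.card (S.map g) = (Cap ⊓ S).relIndex S := by
    rw [← Subgroup.relIndex_ker, hg_ker, Subgroup.inf_relIndex_right]
  have hKside : PK.relIndex S = PK.relIndex (Cap ⊓ S) * Nat.card (S.map g) := by
    rw [hcardgS, Subgroup.relIndex_mul_relIndex PK (Cap ⊓ S) S (le_inf hPK_le_Cap hPK_le_S) inf_le_right]
  have hKside' : PK.relIndex S = (powMonoidHom (α := NarrowClassGroup K) 2).range.index :=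
    relIndex_totPosPrincipalIdeals_sqComap_eq K
  -- (v) Chevalley's narrow formula: `#F · 2 · U = h⁺(K) · ∏ e`
  have hChev : P.relIndex Z * 2 * U =
      narrowClassNumber K * ∏ᶠ v : HeightOneSpectrum (𝓞 K), v.asIdeal.ramificationIdxIn (𝓞 L) := by
    have h := ambiguousNarrowClassNumberFormula' (K := K) (L := L) hσ
    rw [h2] at h
    exact h
  -- (vi) `#T = [Cl⁺(L) : (Cl⁺(L))²]`
  have hLside : (powMonoidHom (α := NarrowClassGroup L) 2).range.index = Nat.card T :=
    index_range_pow_two_narrowClassGroup_eq_card_twoTorsion L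
  -- assemble
  have hmain : Nat.card T * 2 * U * PK.relIndex (Cap ⊓ S) ∣
      (P.relIndex Z * 2 * U) * (PK.relIndex (Cap ⊓ S) * Nat.card (S.map g)) := by
    rw [hT_card, ← hFZ]
    calc Nat.card ψ.ker * Nat.card ψ.range * 2 * U * PK.relIndex (Cap ⊓ S)
        = (Nat.card ψ.ker * 2 * U) * (PK.relIndex (Cap ⊓ S) * Nat.card ψ.range) := by ring
      _ ∣ (Nat.card F * 2 * U) * (PK.relIndex (Cap ⊓ S) * Nat.card (S.map g)) :=
          mul_dvd_mul (mul_dvd_mul (mul_dvd_mul hker_dvd dvd_rfl) dvd_rfl) (mul_dvd_mul dvd_rfl hrange_dvd)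
  rw [hChev, ← hKside, hKside'] at hmain
  rw [hLside]
  calc Nat.card T * 2 * U * PK.relIndex (Cap ⊓ S)
      ∣ narrowClassNumber K * (∏ᶠ v : HeightOneSpectrum (𝓞 K), v.asIdeal.ramificationIdxIn (𝓞 L)) *
          (powMonoidHom (α := NarrowClassGroup K) 2).range.index := hmain
    _ = narrowClassNumber K * (powMonoidHom (α := NarrowClassGroup K) 2).range.index *
          ∏ᶠ v : HeightOneSpectrum (𝓞 K), v.asIdeal.ramificationIdxIn (𝓞 L) := by ring

/-- **The rank inequality for `h(K)` odd**: then `h⁺(K) = h(K) · [Cl⁺(K):(Cl⁺(K))²]` (tree N1), so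
`[Cl⁺(L):(Cl⁺(L))²] · 2 · U⁺ · C ∣ h(K) · [Cl⁺(K):(Cl⁺(K))²]² · ∏_𝔭 e_𝔭` — with `h(K)` odd this reads `ρ_L ≤ 2ρ_K + t − 1 − i⁺ − c` on
`2`-adic valuations. [cite: Gras2003, IV.4] [cite: FrohlichTaylor1990, Ch. V §2] -/
theorem index_range_pow_two_narrowClassGroup_mul_dvd_of_odd_classNumber [IsGalois K L] [IsTotallyReal L] {σ : L ≃ₐ[K] L}
    (hσ : ∀ τ : L ≃ₐ[K] L, τ ∈ Subgroup.zpowers σ) (h2 : Module.finrank K L = 2) (hK : Odd (classNumber K)) :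
    (powMonoidHom (α := NarrowClassGroup L) 2).range.index * 2 *
        ((unitsE L ⊓ (signHom L).ker) ⊓ (⊤ : Subgroup Lˣ).map (Herbrand.norm (L ≃ₐ[K] L))).relIndex
          ((unitsE L ⊓ (signHom L).ker) ⊓ (unitsIncl K L).range) *
        (totPosPrincipalIdeals K).relIndex
          ((totPosPrincipalIdeals L).comap (Units.map (extendedHom L (𝓞 L) :
              FractionalIdeal (𝓞 K)⁰ K →+* FractionalIdeal (𝓞 L)⁰ L).toMonoidHom) ⊓
            (totPosPrincipalIdeals K).comap (powMonoidHom (α := (FractionalIdeal (𝓞 K)⁰ K)ˣ) 2)) ∣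
      classNumber K * (powMonoidHom (α := NarrowClassGroup K) 2).range.index ^ 2 *
        ∏ᶠ v : HeightOneSpectrum (𝓞 K), v.asIdeal.ramificationIdxIn (𝓞 L) := by
  have h := index_range_pow_two_narrowClassGroup_mul_dvd hσ h2
  rw [← index_range_pow_two_narrowClassGroup_mul_classNumber_eq_of_odd_classNumber hK] at h
  calc _ ∣ _ := h
    _ = _ := by ring

end Literature.NumberTheory.NumberFields.AmbiguousClass

end
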